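import Summits.ValiantsHypothesis.ValiantsHypothesis.Theorems.KPlusLogSqLawTropicalBThreeRowTwelveFamily
import Summits.ValiantsHypothesis.ValiantsHypothesis.Theorems.KPlusLogSqLawTropicalBThreeRowEightSigned

/-!
# Route «KPlusLogSqLaw», crux `TropicalB` (stmt-ValiantsHypothesis-19771) — the `m = 3` tropical row for ALL `K`, SIGNED:
# `T(3,K) ≥ 11K − 79` (eleven sign changes per period along the geometric-rail twelve-term family `ThreeRowTwelveFamily`)

HONEST FRAMING.  Helper file (cell `pub-symmetroid`, seat val-sym-trop-p3 g19, 2026-08-29) for the registered stubs of the OPEN crux `TropicalB`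
(item stmt-ValiantsHypothesis-19771; `--supports … --as helper`); a SMALL-FORMAT census row (`m = 3`, every `K`) in the super-fat corner, far off
the crux window.  Nothing here bears on `TropicalB` in its window, `WeakLifting`, the doors, `MatrixDescartes` (stmt-ValiantsHypothesis-18050) or
VP ≠ VNP; a FLOOR refutes no law.
WHAT IS PROVED.  On the self-similar family of `…ThreeRowTwelveFamily` (twelve uniquely dominant terms per period on the rail `11^l·10^(N−l)`,
all `K ≥ 8`), the class-parity sign pattern `ε(a,b,l) = (−1)^(s(a,b) + t(a,b)·l)` (`es`; here `s = 0`) makes ELEVEN of the twelve events of every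
period (all but event 2) alternate, with term signs `chi i · (−1)^Q` in period `Q` (`termSign_sub`), across the period wrap too (`chi_wrap`);
no class-periodic sign pattern of period ≤ 12 keeps all twelve (seat check, GF(2) elimination).  Hence `ThreeRowTwelveFamily.alternating` and
* **`ThreeRowTwelveFamily.not_tropRootLawAt (K') : ¬ TropRootLawAt 3 (K' + 8) (11·K' + 9)`** — **`T(3,K) ≥ 11K − 79` for every `K ≥ 8`**:
  the SIGNED `m = 3` row has slope at least 11 (record `ThreeRowElevenFamily.not_tropRootLawAt`, g17: `10K − 51`, beaten for every `K ≥ 29`;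
  unsigned: `ThreeRowTwelveFamily.not_tropRowD`, `12K − 85`; ceiling: half-thin `⌊(27K − 17)/2⌋`).
Dominance is transported from the unsigned design along equal supports (`ThreeRowEight.isDominant_of_support`).
[this lineage's construction; the rows are the cell's definitions; no citation]
-/

set_option linter.dupNamespace false
set_option autoImplicit false

namespace Summit.ValiantsHypothesis.ValiantsHypothesis.Theorems.KPlusLogSqLaw

open Summit.ValiantsHypothesis.ValiantsHypothesis.Theorems.MatrixDescartes.Negative
open Summit.ValiantsHypothesis.ValiantsHypothesis.Theorems.LacunarySymmetroidMatrixDescartes.TropicalCensus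

namespace ThreeRowTwelveFamily

/-! ## Signed sub-chain: 11 of the 12 events per period alternate in sign (term signs flip with the period parity; the wrap alternates too) -/

/-- sign offsets. -/
def sb : Fin 3 → Fin 3 → ℕ := ![![0, 0, 0], ![0, 0, 0], ![0, 0, 0]]

/-- class-parity bits. -/
def tb : Fin 3 → Fin 3 → ℕ := ![![0, 1, 0], ![1, 0, 1], ![1, 0, 1]]

/-- the signed design `ε = (−1)^(s + t·l)` (every cell present). -/
def es (N : ℕ) : Fin 3 → Fin 3 → Fin (N + 1) → ℤ :=
  fun a b l => (-1) ^ (sb a b + tb a b * (l : ℕ))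

/-- the events used by the signed sub-chain (increasing). -/
def sph : Fin 11 → ℕ := ![0, 1, 3, 4, 5, 6, 7, 8, 9, 10, 11]

/-- term signs of the sub-chain's events in EVEN periods (they flip in odd periods). -/
def chi : Fin 11 → ℤ := ![(-1 : ℤ), 1, (-1 : ℤ), 1, (-1 : ℤ), 1, (-1 : ℤ), 1, (-1 : ℤ), 1, (-1 : ℤ)]

/-- event permutations as value tables. -/
def sgv : Fin 12 → Fin 3 → Fin 3 := ![![2, 1, 0], ![2, 0, 1], ![0, 1, 2], ![2, 1, 0], ![0, 2, 1], ![2, 0, 1], ![1, 2, 0], ![2, 1, 0], ![0, 2, 1], ![1, 2, 0], ![0, 1, 2], ![0, 2, 1]]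

/-- signs of the event permutations. -/
def sgn : Fin 12 → ℤ := ![(-1 : ℤ), 1, 1, (-1 : ℤ), (-1 : ℤ), 1, 1, (-1 : ℤ), (-1 : ℤ), 1, 1, (-1 : ℤ)]

/-- `sg` evaluates to `sgv`. -/
theorem sg_apply : ∀ (j : Fin 12) (i : Fin 3), sg j i = sgv j i := by decide

/-- signs of the event permutations. -/
theorem sign_sg : ∀ j : Fin 12, (Equiv.Perm.sign (sg j) : ℤ) = sgn j := by decide

/-- the sub-chain's events are events. -/
theorem sph_lt : ∀ i : Fin 11, sph i < 12 := by decide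

/-- the sub-chain's events increase. -/
theorem sph_mono : ∀ i i' : Fin 11, i < i' → sph i < sph i' := by decide

/-- index of the `k`-th sub-chain term in the full chain. -/
def kf (k : ℕ) : ℕ := 12 * (k / 11) + sph ⟨k % 11, Nat.mod_lt _ (by norm_num)⟩

/-- period of the `k`-th sub-chain term. -/
theorem kf_div (k : ℕ) : kf k / 12 = k / 11 := by
  unfold kf; have := sph_lt ⟨k % 11, Nat.mod_lt _ (by norm_num)⟩; omega

/-- event of the `k`-th sub-chain term. -/
theorem kf_mod (k : ℕ) : kf k % 12 = sph ⟨k % 11, Nat.mod_lt _ (by norm_num)⟩ := by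
  unfold kf; have := sph_lt ⟨k % 11, Nat.mod_lt _ (by norm_num)⟩; omega

/-- the sub-chain runs through the full chain increasingly. -/
theorem kf_lt_succ (k : ℕ) : kf k < kf (k + 1) := by
  unfold kf
  by_cases h : k % 11 < 10
  · have hmono := sph_mono ⟨k % 11, Nat.mod_lt _ (by norm_num)⟩ ⟨(k + 1) % 11, Nat.mod_lt _ (by norm_num)⟩
      (by simp only [Fin.mk_lt_mk]; omega)
    have : (k + 1) / 11 = k / 11 := by omega
    rw [this]; omega
  · have h1 : (k + 1) / 11 = k / 11 + 1 := by omega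
    have h2 := sph_lt ⟨k % 11, Nat.mod_lt _ (by norm_num)⟩
    rw [h1]; omega

/-- equal supports. -/
theorem es_zero_iff (N : ℕ) (a b : Fin 3) (l : Fin (N + 1)) : ee N a b l = 0 ↔ es N a b l = 0 := by
  simp only [ee, es]
  constructor
  · intro h; norm_num at h
  · intro h
    exact absurd h (pow_ne_zero _ (by norm_num))

/-- signs are in `{0, ±1}`. -/
theorem es_natAbs_le (N : ℕ) (a b : Fin 3) (l : Fin (N + 1)) : (es N a b l).natAbs ≤ 1 := by
  simp only [es]
  rcases neg_one_pow_eq_or ℤ (sb a b + tb a b * (l : ℕ)) with h | h <;> simp [h]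

/-- the term sign of the `i`-th sub-event in period `Q` is `chi i · (−1)^Q`. -/
theorem termSign_sub (K' : ℕ) (i : Fin 11) (q : ℕ) (c : Fin 3 → Fin (K' + 7 + 1))
    (hc : ∀ b, ((c b : Fin (K' + 7 + 1)) : ℕ) = q + co ⟨sph i, sph_lt i⟩ b) :
    termSign (es (K' + 7)) (sg ⟨sph i, sph_lt i⟩, c) = chi i * (-1) ^ (1 * q) := by
  unfold termSign
  rw [Fin.prod_univ_three]
  simp only [sign_sg, sg_apply, es, hc]
  fin_cases i <;>
    simp [sph, sgv, sgn, sb, tb, co, chi, pow_add] <;>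
    (rcases neg_one_pow_eq_or ℤ q with h | h <;> try simp [h])

/-- consecutive sub-chain signs alternate inside a period. -/
theorem chi_alt_in : ∀ i : Fin 11, (i : ℕ) < 10 → chi i * chi (i + 1) < 0 := by decide

/-- across the period wrap (the period parity flips one factor). -/
theorem chi_wrap : chi 10 * chi 0 > 0 := by decide

/-- **The signed chain**: `11(K'+1)` alternating uniquely dominant terms, format `(3, K'+8)`. -/
theorem alternating (K' : ℕ) :
    ∃ (d : Fin (K' + 7 + 1) → ℕ) (v ε : Fin 3 → Fin 3 → Fin (K' + 7 + 1) → ℤ), (∀ i j l, (ε i j l).natAbs ≤ 1) ∧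
      ∃ (θ : Fin (11 * K' + 10 + 1) → ℤ) (p : Fin (11 * K' + 10 + 1) → Equiv.Perm (Fin 3) × (Fin 3 → Fin (K' + 7 + 1))),
        StrictMono θ ∧ (∀ k, IsDominant d v ε (θ k) (p k)) ∧
        ∀ k : Fin (11 * K' + 10), termSign ε (p k.castSucc) * termSign ε (p k.succ) < 0 := by
  have hkK : ∀ k : Fin (11 * K' + 10 + 1), kf (k : ℕ) / 12 ≤ K' := fun k => by rw [kf_div]; have := k.isLt; omega
  refine ⟨dd (K' + 7), vv (K' + 7), es (K' + 7), es_natAbs_le (K' + 7), fun k => th (kf k), fun k => (sg (ph (kf k)), cl K' (kf k) (hkK k)),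
    ?_, ?_, ?_⟩
  · refine Fin.strictMono_iff_lt_succ.mpr ?_
    intro k
    simp only [Fin.val_castSucc, Fin.val_succ]
    exact th_strictMono (kf_lt_succ (k : ℕ))
  · intro k
    exact ThreeRowEight.isDominant_of_support _ _ _ _ (es_zero_iff (K' + 7)) _ _ (dominant K' (kf k) (hkK k))
  · intro k
    have hph : ∀ k' : ℕ, ph (kf k') = ⟨sph ⟨k' % 11, Nat.mod_lt _ (by norm_num)⟩, sph_lt _⟩ := by
      intro k'; apply Fin.ext; simp only [ph]; exact kf_mod k'
    have hcl : ∀ (k' : ℕ) (hk : kf k' / 12 ≤ K') (b : Fin 3),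
        ((cl K' (kf k') hk b : Fin (K' + 7 + 1)) : ℕ) = k' / 11 + co ⟨sph ⟨k' % 11, Nat.mod_lt _ (by norm_num)⟩, sph_lt _⟩ b := by
      intro k' hk b
      show kf k' / 12 + co (ph (kf k')) b = _
      rw [kf_div, hph]
    have h1 := termSign_sub K' ⟨(k : ℕ) % 11, Nat.mod_lt _ (by norm_num)⟩ ((k : ℕ) / 11) (cl K' (kf k) (hkK k.castSucc))
      (hcl k (hkK k.castSucc))
    have h2 := termSign_sub K' ⟨((k : ℕ) + 1) % 11, Nat.mod_lt _ (by norm_num)⟩ (((k : ℕ) + 1) / 11) (cl K' (kf (k + 1)) (hkK k.succ))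
      (hcl (k + 1) (hkK k.succ))
    simp only [Fin.val_castSucc, Fin.val_succ]
    rw [← hph k] at h1
    rw [← hph (k + 1)] at h2
    rw [h1, h2]
    by_cases h : (k : ℕ) % 11 < 10
    · have hq : ((k : ℕ) + 1) / 11 = (k : ℕ) / 11 := by omega
      have hi : (⟨((k : ℕ) + 1) % 11, Nat.mod_lt _ (by norm_num)⟩ : Fin 11) = ⟨(k : ℕ) % 11, Nat.mod_lt _ (by norm_num)⟩ + 1 := by
        apply Fin.ext; simp only [Fin.val_add]; omega
      rw [hq, hi]
      have hc := chi_alt_in ⟨(k : ℕ) % 11, Nat.mod_lt _ (by norm_num)⟩ (by simpa using h)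
      have hsq : ((-1 : ℤ) ^ (1 * ((k : ℕ) / 11))) * ((-1 : ℤ) ^ (1 * ((k : ℕ) / 11))) = 1 := by
        rw [← pow_add, ← two_mul, pow_mul]; simp
      nlinarith [hc, hsq]
    · have hq : ((k : ℕ) + 1) / 11 = (k : ℕ) / 11 + 1 := by omega
      have hi0 : (⟨((k : ℕ) + 1) % 11, Nat.mod_lt _ (by norm_num)⟩ : Fin 11) = 0 := by
        apply Fin.ext; simp; omega
      have hi7 : (⟨(k : ℕ) % 11, Nat.mod_lt _ (by norm_num)⟩ : Fin 11) = 10 := by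
        apply Fin.ext; simp; omega
      rw [hq, hi0, hi7]
      have hc := chi_wrap
      have hsq : ((-1 : ℤ) ^ (1 * ((k : ℕ) / 11))) * ((-1 : ℤ) ^ (1 * ((k : ℕ) / 11))) = 1 := by
        rw [← pow_add, ← two_mul, pow_mul]; simp
      have hstep : ((-1 : ℤ) ^ (1 * ((k : ℕ) / 11 + 1))) = (-1) ^ 1 * (-1 : ℤ) ^ (1 * ((k : ℕ) / 11)) := by
        rw [mul_add, mul_one, pow_add, mul_comm]
      rw [hstep]
      have key : chi 10 * (-1 : ℤ) ^ (1 * ((k : ℕ) / 11)) * (chi 0 * ((-1) ^ 1 * (-1 : ℤ) ^ (1 * ((k : ℕ) / 11))))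
          = ((-1 : ℤ) ^ 1) * (chi 10 * chi 0) * (((-1 : ℤ) ^ (1 * ((k : ℕ) / 11))) * ((-1 : ℤ) ^ (1 * ((k : ℕ) / 11)))) := by ring
      rw [key, hsq]
      norm_num
      linarith [hc]

end ThreeRowTwelveFamily

/-- **Signed `(3,K)` row floor, all `K ≥ 8`:** `¬ TropRootLawAt 3 (K'+8) (11K'+9)`, i.e. `T(3,K) ≥ 11K − 79`. -/
theorem ThreeRowTwelveFamily.not_tropRootLawAt (K' : ℕ) : ¬ TropRootLawAt 3 (K' + 8) (11 * K' + 9) := by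
  intro h
  obtain ⟨d, v, ε, hε, θ, p, hθ, hdom, halt⟩ := ThreeRowTwelveFamily.alternating K'
  have := h d v ε (11 * K' + 10) θ p hε hθ hdom halt
  omega

end Summit.ValiantsHypothesis.ValiantsHypothesis.Theorems.KPlusLogSqLaw
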